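import Summits.QuantumFields.YangMills.Theorems.BalabanUVNodesN19KingLocalTwoClass

/-!
# BalabanUVNodes ∕ node N19 (NE7) — AN IDEAL DEFECT GAS: the first inhabitant of `Spine.NE7.Core` ∕ `HybridNE7` with MANY GOOD CLASSES sharing ONE EXTENSIVE constant
# `c_K = |Λ|·(log g′_K − log g_K)` and a VOLUME-FREE remainder `n·ε_K` (good classes = defect sets of size `≤ n`, bad classes = the larger ones, weight `(1 + q_K)^{|Λ|} − 1`)

Cell `pub-ymgap` (HUMAN RULING D-0062 Track A ∕ D-0149 width seats), WIDTH SEAT `pub-ymgap-dag-n19-w1` (node n19 = NE7, seat 1 of 3), INTENT-3; successor of this seat's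
`…Theorems.BalabanUVNodesN19KingLocalTwoClass` (p584100) and `…N19PureShellClasses`.  Route `Summits/QuantumFields/YangMills/Theses/BalabanUVNodes.lean`, key item K3⁷
`SpineGivenEndpointR13SepCoPH` (stmt-QuantumFields-20544); filed `--kind proof --supports … --as helper`.  COUNT-NEUTRAL.  THEOREMS ONLY (0 `def`, 0 `sorry`).  ADDITIVE — imports
p584100 (through it `Spine/NE7/Targets` (`Core`), `T4MatchingAssembly` (`HybridNE7`, `hybridNE7_noShell`), `T4WeightBudget` (`RelWeightBound`), `T4CauchySum`
(`two_sided_of_abs_log_sub_le`)) and Mathlib (`Finset.prod_add`-type binomial bookkeeping `Finset.sum_pow_mul_eq_add_pow`, `Real.log_prod`) — CITED BY NAME; modifies nothing.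

WHY.  `Spine.NE7.Core l₀ vol T Bad P Q δ` asks, per run length `K`, for ONE constant `c_K` — independent of the source `t` AND OF THE CLASS `τ` — sandwiching run B's core against run
A's on EVERY good class.  Every inhabitant in the tree has at most ONE good class per level (King storeys: `ι = Unit`, or `Bool` with the bad class `{true}`; p584100), so the
class-uniformity of `c_K` — the clause's distinctive content (p584100's reading: with one good class `Core` is implied by total matching + weights) — has never been exercised.  This file
exhibits it in the simplest honest model, an IDEAL GAS OF DEFECTS on a finite site set `Λ`: a class is the defect set `D ⊆ Λ`; run A weighs a configuration by `a_K(x)·e^{t·w_d(x)}`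
per defect and `g_K·e^{t·w₀}` per vacuum site, run B by `a′_K(x)·e^{t·w_d(x)}` and `g′_K·e^{t·w₀}`; the two runs' per-defect RELATIVE weights agree up to `e^{±ε_K}`
(`|log(a′∕a) − log(g′∕g)| ≤ ε_K`).  Then on every class `log B_D − log A_D = |Λ|·log(g′∕g) + Σ_{x∈D} r_K(x)` with `|r_K| ≤ ε_K`: the constant is EXTENSIVE (a free-energy shift
`∝ |Λ|`, the same for all classes), the remainder is `≤ |D|·ε_K` — per defect, volume-free — so `Core` holds with `δ_K = n·ε_K∕vol` on the good classes `|D| ≤ n` (as many as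
`Σ_{k≤n} C(|Λ|,k)`), the bad classes `|D| > n` carry relative weight `≤ (1 + q_K)^{|Λ|} − 1` (`q_K = p_K·e^{2l₀B₀}`, `a ≤ p·g`), and `HybridNE7` follows with NE7b PRODUCED.  This is the
NE7 mechanism in caricature — extensive constant, per-defect remainder, large defect sets cut into the weight — and an A6 inhabitant of the `hedge` shape with both quantifiers of
`∃ c ∀ τ ∈ T K ∖ Bad K t` non-vacuous.
* §1 [folklore] per-class algebra: `defectTerm_pos` · `log_defectTerm` · ★ `log_ratio_sub_extensive_eq` · ★ `abs_log_ratio_sub_extensive_le`.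
* §2 [folklore] ★★ `core_defectGas` (MANY good classes, one extensive constant, `δ_K = n·ε_K∕vol`; NO weight hypothesis) · `exists_core_summable_defectGas` · `good_iff` ·
  `goodClasses_nondegenerate` (∅ and every singleton are good for `n ≥ 1`; `Λ` itself is bad for `n < |Λ|`).
* §3 [folklore] weights: `defectTerm_le_pow_mul_vacuum` · `sum_pow_card_erase_empty` · ★ `sum_bad_le_defectGas` · ★ `relWeightBound_defectGas` · ★★ `hybridNE7_defectGas` (the two
  weight conditions displayed) · `weight_geometric_le` · ★★ `hybridNE7_defectGas_geometric` (geometric defect density `p_K = p₀r^K`: both weight conditions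
  DISCHARGED up to the one displayed numeric condition `|Λ|·p₀e^{2l₀B₀}(1 + p₀e^{2l₀B₀})^{|Λ|} < 1`).
* §4 [folklore] ★ `exists_totalCore_not_core` — SHARPNESS of p584100's un-hybrid direction: with TWO good classes an EXACT matching of the totals gives `Core` for NO summable `δ`.

HONEST FRAMING.  A finite TOY (ideal defect gas; product weights) — NOT King's model, NOT Bałaban's NE7 ∕ NE7b (NOT PRINTED as two-run statements for d = 4; NODE O's objects),
nothing of Bałaban's instantiated or asserted; no estimate of the programme is proved.  Count-neutral; N19 NOT discharged (0∕1); K3⁷ NOT claimed; counts UNMOVED (typed 28∕28 ·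
discharged 5∕27).  Everything PROVED (0 `sorry`, 0 named facts, standard axioms).  One finite four-torus programme at fixed ε — NOT ℝ⁴, NOT OS, NOT a mass gap, NOT the Clay problem.
-/

noncomputable section

namespace Summit.QuantumFields.YangMills.BalabanUVNodes.N19DefectGasManyClasses

open Real
open scoped BigOperators
open Summit.QuantumFields.BalabanUV.T4Continuum.Spine.NE7 (Core)
open Literature.MathematicalPhysics.QuantumFieldTheory.Balaban1983to89.T4WeightBudget (RelWeightBound)
open Literature.MathematicalPhysics.QuantumFieldTheory.Balaban1983to89.T4MatchingAssembly (HybridNE7 hybridNE7_noShell)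
open Literature.MathematicalPhysics.QuantumFieldTheory.Balaban1983to89.T4CauchySum (two_sided_of_abs_log_sub_le)

variable {α : Type*} [DecidableEq α]

/-! ## §1 Per-class algebra of the defect gas -/
section Algebra

variable {D S : Finset α} {f : α → ℝ} {c t w0 : ℝ} {wd : α → ℝ}

omit [DecidableEq α] in
/-- A defect-gas term `(Π_{x∈D} f(x)e^{t·w_d(x)})·(Π_{x∈S} c·e^{t·w₀})` with positive letters is positive. [folklore] -/
theorem defectTerm_pos (hf : ∀ x ∈ D, 0 < f x) (hc : 0 < c) :
    0 < (∏ x ∈ D, f x * Real.exp (t * wd x)) * ∏ _x ∈ S, c * Real.exp (t * w0) :=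
  mul_pos (Finset.prod_pos fun x hx => mul_pos (hf x hx) (Real.exp_pos _)) (Finset.prod_pos fun _ _ => mul_pos hc (Real.exp_pos _))

omit [DecidableEq α] in
/-- Its logarithm: `Σ_{x∈D} (log f(x) + t·w_d(x)) + |S|·(log c + t·w₀)`. [folklore] -/
theorem log_defectTerm (hf : ∀ x ∈ D, 0 < f x) (hc : 0 < c) :
    Real.log ((∏ x ∈ D, f x * Real.exp (t * wd x)) * ∏ _x ∈ S, c * Real.exp (t * w0))
      = ∑ x ∈ D, (Real.log (f x) + t * wd x) + S.card * (Real.log c + t * w0) := by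
  rw [Real.log_mul (Finset.prod_pos fun x hx => mul_pos (hf x hx) (Real.exp_pos _)).ne' (Finset.prod_pos fun _ _ => mul_pos hc (Real.exp_pos _)).ne',
    Real.log_prod (fun x hx => (mul_pos (hf x hx) (Real.exp_pos _)).ne'), Real.log_prod (fun _ _ => (mul_pos hc (Real.exp_pos _)).ne'),
    Finset.sum_const, nsmul_eq_mul]
  congr 1
  · exact Finset.sum_congr rfl fun x hx => by rw [Real.log_mul (hf x hx).ne' (Real.exp_pos _).ne', Real.log_exp]
  · rw [Real.log_mul hc.ne' (Real.exp_pos _).ne', Real.log_exp]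

variable {Λ : Finset α} {a a' : α → ℝ} {g g' : ℝ}

/-- **★ THE TWO-RUN LOG-RATIO OF A CLASS IS AN EXTENSIVE CONSTANT PLUS A PER-DEFECT SUM** [folklore]: for `D ⊆ Λ`,
`log B_D − log A_D − |Λ|·(log g′ − log g) = Σ_{x∈D} ((log a′(x) − log a(x)) − (log g′ − log g))` — the dressings `e^{t·w_d}`, `e^{t·w₀}` cancel identically. -/
theorem log_ratio_sub_extensive_eq (hD : D ⊆ Λ) (ha : ∀ x ∈ D, 0 < a x) (ha' : ∀ x ∈ D, 0 < a' x) (hg : 0 < g) (hg' : 0 < g') :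
    Real.log ((∏ x ∈ D, a' x * Real.exp (t * wd x)) * ∏ _x ∈ Λ \ D, g' * Real.exp (t * w0))
        - Real.log ((∏ x ∈ D, a x * Real.exp (t * wd x)) * ∏ _x ∈ Λ \ D, g * Real.exp (t * w0))
        - Λ.card * (Real.log g' - Real.log g)
      = ∑ x ∈ D, ((Real.log (a' x) - Real.log (a x)) - (Real.log g' - Real.log g)) := by
  rw [log_defectTerm ha' hg', log_defectTerm ha hg]
  have hcard : ((Λ \ D).card : ℝ) + D.card = Λ.card := by exact_mod_cast Finset.card_sdiff_add_card_eq_card hD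
  have hdiff : ∑ x ∈ D, (Real.log (a' x) + t * wd x) - ∑ x ∈ D, (Real.log (a x) + t * wd x) = ∑ x ∈ D, (Real.log (a' x) - Real.log (a x)) := by
    rw [← Finset.sum_sub_distrib]
    exact Finset.sum_congr rfl fun x _ => by ring
  have hrhs : ∑ x ∈ D, ((Real.log (a' x) - Real.log (a x)) - (Real.log g' - Real.log g))
      = ∑ x ∈ D, (Real.log (a' x) - Real.log (a x)) - D.card * (Real.log g' - Real.log g) := by
    rw [Finset.sum_sub_distrib, Finset.sum_const, nsmul_eq_mul]
  rw [hrhs]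
  linear_combination hdiff + (Real.log g' - Real.log g) * hcard

/-- **★ … HENCE WITHIN `|D|·ε` OF THE EXTENSIVE CONSTANT** [folklore]: if `|(log a′(x) − log a(x)) − (log g′ − log g)| ≤ ε` for every defect site `x ∈ D`, then
`|log B_D − log A_D − |Λ|·(log g′ − log g)| ≤ |D|·ε`. -/
theorem abs_log_ratio_sub_extensive_le {ε : ℝ} (hD : D ⊆ Λ) (ha : ∀ x ∈ D, 0 < a x) (ha' : ∀ x ∈ D, 0 < a' x) (hg : 0 < g) (hg' : 0 < g')
    (hε : ∀ x ∈ D, |(Real.log (a' x) - Real.log (a x)) - (Real.log g' - Real.log g)| ≤ ε) :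
    |Real.log ((∏ x ∈ D, a' x * Real.exp (t * wd x)) * ∏ _x ∈ Λ \ D, g' * Real.exp (t * w0))
        - Real.log ((∏ x ∈ D, a x * Real.exp (t * wd x)) * ∏ _x ∈ Λ \ D, g * Real.exp (t * w0))
        - Λ.card * (Real.log g' - Real.log g)| ≤ D.card * ε := by
  rw [log_ratio_sub_extensive_eq hD ha ha' hg hg']
  calc _ ≤ ∑ x ∈ D, |(Real.log (a' x) - Real.log (a x)) - (Real.log g' - Real.log g)| := Finset.abs_sum_le_sum_abs _ _
    _ ≤ ∑ x ∈ D, ε := Finset.sum_le_sum hε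
    _ = D.card * ε := by rw [Finset.sum_const, nsmul_eq_mul]

end Algebra

/-! ## §2 `Core` with many good classes and one extensive constant -/
section CoreMany

variable (Λ : Finset α) (n : ℕ) {l₀ vol w0 : ℝ} {wd : α → ℝ} {a a' : ℕ → α → ℝ} {g g' ε : ℕ → ℝ}

/-- **★★ `Spine.NE7.Core` FOR THE IDEAL DEFECT GAS — MANY GOOD CLASSES, ONE EXTENSIVE CONSTANT, A VOLUME-FREE REMAINDER** [folklore ∘ §1 + `T4CauchySum.two_sided_of_abs_log_sub_le`].
Classes = defect sets `D ⊆ Λ` (`T K = Λ.powerset`); bad classes = `|D| > n`; run A's term `(Π_{x∈D} a_K(x)e^{t·w_d(x)})·(g_K e^{t·w₀})^{|Λ∖D|}`, run B's with `a′_K`, `g′_K`; letters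
positive with `|log(a′_K(x)∕a_K(x)) − log(g′_K∕g_K)| ≤ ε_K` on `Λ` (`ε_K ≥ 0`).  Then `Core l₀ vol T Bad A B (K ↦ n·ε_K∕vol)` with the constant `c_K = |Λ|·(log g′_K − log g_K)` serving
EVERY good class at once.  NO hypothesis on the defect density (the weights enter §3 only); `t` and `l₀` arbitrary. -/
theorem core_defectGas (hvol : 0 < vol) (hg : ∀ K, 0 < g K) (hg' : ∀ K, 0 < g' K) (ha : ∀ K, ∀ x ∈ Λ, 0 < a K x) (ha' : ∀ K, ∀ x ∈ Λ, 0 < a' K x)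
    (hε0 : ∀ K, 0 ≤ ε K) (hε : ∀ K, ∀ x ∈ Λ, |(Real.log (a' K x) - Real.log (a K x)) - (Real.log (g' K) - Real.log (g K))| ≤ ε K) :
    Core l₀ vol (fun _ => Λ.powerset) (fun _ _ => Λ.powerset.filter fun D => n < D.card)
      (fun K t D => (∏ x ∈ D, a K x * Real.exp (t * wd x)) * ∏ _x ∈ Λ \ D, g K * Real.exp (t * w0))
      (fun K t D => (∏ x ∈ D, a' K x * Real.exp (t * wd x)) * ∏ _x ∈ Λ \ D, g' K * Real.exp (t * w0))
      fun K => n * ε K / vol := by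
  intro K
  refine ⟨Λ.card * (Real.log (g' K) - Real.log (g K)), fun t _ D hD => ?_⟩
  rw [Finset.mem_sdiff, Finset.mem_powerset, Finset.mem_filter, not_and, Finset.mem_powerset] at hD
  have hDΛ : D ⊆ Λ := hD.1
  have hDn : D.card ≤ n := not_lt.mp (hD.2 hDΛ)
  have hlog := abs_log_ratio_sub_extensive_le (t := t) (wd := wd) (w0 := w0) hDΛ (fun x hx => ha K x (hDΛ hx)) (fun x hx => ha' K x (hDΛ hx)) (hg K) (hg' K)
    fun x hx => hε K x (hDΛ hx)
  have hbound : (D.card : ℝ) * ε K ≤ vol * (n * ε K / vol) := by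
    rw [mul_div_cancel₀ _ hvol.ne']
    exact mul_le_mul_of_nonneg_right (by exact_mod_cast hDn) (hε0 K)
  exact two_sided_of_abs_log_sub_le (defectTerm_pos (fun x hx => ha K x (hDΛ hx)) (hg K)) (defectTerm_pos (fun x hx => ha' K x (hDΛ hx)) (hg' K))
    (hlog.trans hbound)

/-- **THE `hedge` ∕ `h19` SHAPE `∃ δ, Core … δ ∧ Summable δ` ON THE DEFECT GAS** [folklore ∘ `core_defectGas`]: with `Σ ε_K < ∞`, `δ_K = n·ε_K∕vol` displayed. -/
theorem exists_core_summable_defectGas (hvol : 0 < vol) (hg : ∀ K, 0 < g K) (hg' : ∀ K, 0 < g' K) (ha : ∀ K, ∀ x ∈ Λ, 0 < a K x)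
    (ha' : ∀ K, ∀ x ∈ Λ, 0 < a' K x) (hε0 : ∀ K, 0 ≤ ε K) (hεs : Summable ε)
    (hε : ∀ K, ∀ x ∈ Λ, |(Real.log (a' K x) - Real.log (a K x)) - (Real.log (g' K) - Real.log (g K))| ≤ ε K) :
    ∃ δ : ℕ → ℝ, Core l₀ vol (fun _ => Λ.powerset) (fun _ _ => Λ.powerset.filter fun D => n < D.card)
      (fun K t D => (∏ x ∈ D, a K x * Real.exp (t * wd x)) * ∏ _x ∈ Λ \ D, g K * Real.exp (t * w0))
      (fun K t D => (∏ x ∈ D, a' K x * Real.exp (t * wd x)) * ∏ _x ∈ Λ \ D, g' K * Real.exp (t * w0)) δ ∧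
      Summable δ ∧ ∀ K, δ K = n * ε K / vol :=
  ⟨_, core_defectGas Λ n hvol hg hg' ha ha' hε0 hε, (hεs.mul_left (n : ℝ)).div_const vol, fun _ => rfl⟩

/-- The good classes are exactly the defect sets of size `≤ n`. [folklore] -/
theorem good_iff {D : Finset α} :
    D ∈ Λ.powerset \ Λ.powerset.filter (fun D => n < D.card) ↔ D ⊆ Λ ∧ D.card ≤ n := by
  rw [Finset.mem_sdiff, Finset.mem_filter, Finset.mem_powerset, not_and, not_lt]
  exact ⟨fun h => ⟨h.1, h.2 h.1⟩, fun h => ⟨h.1, fun _ => h.2⟩⟩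

/-- **NON-DEGENERACY DISPLAYED**: for `n ≥ 1` the empty defect set AND every singleton `{x}`, `x ∈ Λ`, are DISTINCT good classes (so `|Λ| + 1 ≥ 2` good classes share the
constant `c_K` as soon as `Λ ≠ ∅`), and for `n < |Λ|` the full defect set `Λ` is bad (the bad class is non-empty). [folklore] -/
theorem goodClasses_nondegenerate (hn : 1 ≤ n) :
    (∅ ∈ Λ.powerset \ Λ.powerset.filter (fun D => n < D.card)) ∧
      (∀ x ∈ Λ, {x} ∈ Λ.powerset \ Λ.powerset.filter (fun D => n < D.card) ∧ ({x} : Finset α) ≠ ∅) ∧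
      (n < Λ.card → Λ ∈ Λ.powerset.filter fun D => n < D.card) := by
  refine ⟨(good_iff Λ n).2 ⟨Finset.empty_subset _, by simp⟩, fun x hx => ⟨(good_iff Λ n).2 ⟨Finset.singleton_subset_iff.2 hx, by simpa using hn⟩,
    Finset.singleton_ne_empty x⟩, fun h => Finset.mem_filter.2 ⟨Finset.mem_powerset.2 le_rfl, h⟩⟩

end CoreMany

/-! ## §3 The weights: large defect sets are rare in an ideal gas of rare defects -/
section Weights

variable (Λ : Finset α) (n : ℕ) {l₀ vol w0 B₀ : ℝ} {wd : α → ℝ} {a a' : ℕ → α → ℝ} {g g' p ε : ℕ → ℝ}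

/-- **A CLASS WITH `|D|` DEFECTS WEIGHS AT MOST `q^{|D|}` TIMES THE VACUUM CLASS** [folklore]: for `D ⊆ Λ`, `|t| ≤ l₀`, `|w₀|, |w_d| ≤ B₀`, `0 ≤ a(x) ≤ p·c` on `Λ`, `c > 0`:
`(Π_D a e^{t w_d})·(Π_{Λ∖D} c e^{t w₀}) ≤ (p·e^{2l₀B₀})^{|D|}·Π_Λ c e^{t w₀}`. -/
theorem defectTerm_le_pow_mul_vacuum {D : Finset α} (hD : D ⊆ Λ) {t : ℝ} (ht : |t| ≤ l₀) {c q₀ : ℝ} {f : α → ℝ} (hc : 0 < c) (hq : 0 ≤ q₀)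
    (hf0 : ∀ x ∈ Λ, 0 ≤ f x) (hf : ∀ x ∈ Λ, f x ≤ q₀ * c) (hw0 : |w0| ≤ B₀) (hwd : ∀ x ∈ Λ, |wd x| ≤ B₀) :
    (∏ x ∈ D, f x * Real.exp (t * wd x)) * ∏ _x ∈ Λ \ D, c * Real.exp (t * w0)
      ≤ (q₀ * Real.exp (2 * (l₀ * B₀))) ^ D.card * ∏ _x ∈ Λ, c * Real.exp (t * w0) := by
  have hexp : ∀ x ∈ D, Real.exp (t * wd x) ≤ Real.exp (t * w0) * Real.exp (2 * (l₀ * B₀)) := fun x hx => by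
    rw [← Real.exp_add]
    refine Real.exp_le_exp.2 ?_
    have h1 : t * wd x - t * w0 ≤ |t| * (|wd x| + |w0|) := by
      calc t * wd x - t * w0 = t * (wd x - w0) := by ring
        _ ≤ |t * (wd x - w0)| := le_abs_self _
        _ = |t| * |wd x - w0| := abs_mul _ _
        _ ≤ |t| * (|wd x| + |w0|) := mul_le_mul_of_nonneg_left (abs_sub _ _) (abs_nonneg _)
    have h2 : |t| * (|wd x| + |w0|) ≤ l₀ * (B₀ + B₀) :=
      mul_le_mul ht (add_le_add (hwd x (hD hx)) hw0) (add_nonneg (abs_nonneg _) (abs_nonneg _)) ((abs_nonneg t).trans ht)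
    linarith
  have hfac : ∀ x ∈ D, f x * Real.exp (t * wd x) ≤ (q₀ * Real.exp (2 * (l₀ * B₀))) * (c * Real.exp (t * w0)) := fun x hx => by
    calc f x * Real.exp (t * wd x) ≤ (q₀ * c) * (Real.exp (t * w0) * Real.exp (2 * (l₀ * B₀))) :=
          mul_le_mul (hf x (hD hx)) (hexp x hx) (Real.exp_pos _).le (mul_nonneg hq hc.le)
      _ = (q₀ * Real.exp (2 * (l₀ * B₀))) * (c * Real.exp (t * w0)) := by ring
  calc (∏ x ∈ D, f x * Real.exp (t * wd x)) * ∏ _x ∈ Λ \ D, c * Real.exp (t * w0)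
      ≤ (∏ _x ∈ D, (q₀ * Real.exp (2 * (l₀ * B₀))) * (c * Real.exp (t * w0))) * ∏ _x ∈ Λ \ D, c * Real.exp (t * w0) :=
        mul_le_mul_of_nonneg_right (Finset.prod_le_prod (fun x hx => mul_nonneg (hf0 x (hD hx)) (Real.exp_pos _).le) hfac)
          (Finset.prod_nonneg fun _ _ => (mul_pos hc (Real.exp_pos _)).le)
    _ = (q₀ * Real.exp (2 * (l₀ * B₀))) ^ D.card * ((∏ _x ∈ Λ \ D, c * Real.exp (t * w0)) * ∏ _x ∈ D, c * Real.exp (t * w0)) := by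
        rw [Finset.prod_mul_distrib, Finset.prod_const]; ring
    _ = (q₀ * Real.exp (2 * (l₀ * B₀))) ^ D.card * ∏ _x ∈ Λ, c * Real.exp (t * w0) := by rw [Finset.prod_sdiff hD]

/-- `Σ_{∅ ≠ D ⊆ Λ} q^{|D|} = (1 + q)^{|Λ|} − 1` (binomial theorem, Mathlib `Finset.sum_pow_mul_eq_add_pow`). [folklore] -/
theorem sum_pow_card_erase_empty (q₀ : ℝ) : ∑ D ∈ Λ.powerset.erase ∅, q₀ ^ D.card = (1 + q₀) ^ Λ.card - 1 := by
  have h := Finset.sum_pow_mul_eq_add_pow q₀ (1 : ℝ) Λ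
  simp only [one_pow, mul_one] at h
  rw [Finset.sum_erase_eq_sub (Finset.empty_mem_powerset Λ), h, Finset.card_empty, pow_zero, add_comm]

/-- **★ THE BAD CLASSES OF THE DEFECT GAS HAVE RELATIVE WEIGHT `≤ (1 + q)^{|Λ|} − 1`** [folklore ∘ the two lemmas above], `q = p·e^{2l₀B₀}`: every bad class is a non-empty defect set,
each weighs `≤ q^{|D|}·(vacuum class)`, the vacuum class is one of the (nonnegative) terms. -/
theorem sum_bad_le_defectGas {t : ℝ} (ht : |t| ≤ l₀) {c q₀ : ℝ} {f : α → ℝ} (hc : 0 < c) (hq : 0 ≤ q₀) (hf0 : ∀ x ∈ Λ, 0 ≤ f x)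
    (hf : ∀ x ∈ Λ, f x ≤ q₀ * c) (hw0 : |w0| ≤ B₀) (hwd : ∀ x ∈ Λ, |wd x| ≤ B₀) :
    ∑ D ∈ Λ.powerset.filter (fun D => n < D.card), (∏ x ∈ D, f x * Real.exp (t * wd x)) * ∏ _x ∈ Λ \ D, c * Real.exp (t * w0)
      ≤ ((1 + q₀ * Real.exp (2 * (l₀ * B₀))) ^ Λ.card - 1) *
        ∑ D ∈ Λ.powerset, (∏ x ∈ D, f x * Real.exp (t * wd x)) * ∏ _x ∈ Λ \ D, c * Real.exp (t * w0) := by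
  set q := q₀ * Real.exp (2 * (l₀ * B₀)) with hqdef
  have hq' : 0 ≤ q := mul_nonneg hq (Real.exp_pos _).le
  have hterm0 : ∀ D ∈ Λ.powerset, 0 ≤ (∏ x ∈ D, f x * Real.exp (t * wd x)) * ∏ _x ∈ Λ \ D, c * Real.exp (t * w0) := fun D hD =>
    mul_nonneg (Finset.prod_nonneg fun x hx => mul_nonneg (hf0 x (Finset.mem_powerset.1 hD hx)) (Real.exp_pos _).le)
      (Finset.prod_nonneg fun _ _ => (mul_pos hc (Real.exp_pos _)).le)
  have hsub : Λ.powerset.filter (fun D => n < D.card) ⊆ Λ.powerset.erase ∅ := fun D hD => by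
    rw [Finset.mem_filter] at hD
    refine Finset.mem_erase.2 ⟨?_, hD.1⟩
    rintro rfl
    simp at hD
  have hvac : ∏ _x ∈ Λ, c * Real.exp (t * w0) = (∏ x ∈ (∅ : Finset α), f x * Real.exp (t * wd x)) * ∏ _x ∈ Λ \ ∅, c * Real.exp (t * w0) := by
    rw [Finset.prod_empty, one_mul, Finset.sdiff_empty]
  have hvac_le : ∏ _x ∈ Λ, c * Real.exp (t * w0) ≤ ∑ D ∈ Λ.powerset, (∏ x ∈ D, f x * Real.exp (t * wd x)) * ∏ _x ∈ Λ \ D, c * Real.exp (t * w0) := by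
    rw [hvac]
    exact Finset.single_le_sum hterm0 (Finset.empty_mem_powerset Λ)
  have hW0 : 0 ≤ (1 + q) ^ Λ.card - 1 := sub_nonneg.2 (one_le_pow₀ (by linarith))
  calc ∑ D ∈ Λ.powerset.filter (fun D => n < D.card), (∏ x ∈ D, f x * Real.exp (t * wd x)) * ∏ _x ∈ Λ \ D, c * Real.exp (t * w0)
      ≤ ∑ D ∈ Λ.powerset.erase ∅, (∏ x ∈ D, f x * Real.exp (t * wd x)) * ∏ _x ∈ Λ \ D, c * Real.exp (t * w0) :=
        Finset.sum_le_sum_of_subset_of_nonneg hsub fun D hD _ => hterm0 D (Finset.mem_of_mem_erase hD)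
    _ ≤ ∑ D ∈ Λ.powerset.erase ∅, q ^ D.card * ∏ _x ∈ Λ, c * Real.exp (t * w0) :=
        Finset.sum_le_sum fun D hD => defectTerm_le_pow_mul_vacuum Λ (Finset.mem_powerset.1 (Finset.mem_of_mem_erase hD)) ht hc hq hf0 hf hw0 hwd
    _ = ((1 + q) ^ Λ.card - 1) * ∏ _x ∈ Λ, c * Real.exp (t * w0) := by rw [← Finset.sum_mul, sum_pow_card_erase_empty]
    _ ≤ ((1 + q) ^ Λ.card - 1) * ∑ D ∈ Λ.powerset, (∏ x ∈ D, f x * Real.exp (t * wd x)) * ∏ _x ∈ Λ \ D, c * Real.exp (t * w0) :=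
        mul_le_mul_of_nonneg_left hvac_le hW0

/-- **★ NE7b PRODUCED FOR THE DEFECT GAS** [folklore ∘ `sum_bad_le_defectGas`]: with `0 ≤ a_K ≤ p_K·g_K`, `0 ≤ a′_K ≤ p_K·g′_K` on `Λ`, bounded dressings and the weights
`W_K := (1 + p_K e^{2l₀B₀})^{|Λ|} − 1` below one and summable (both displayed; e.g. `p_K` small geometric), `RelWeightBound l₀ powerset A B {|D| > n} W`. -/
theorem relWeightBound_defectGas (hg : ∀ K, 0 < g K) (hg' : ∀ K, 0 < g' K) (hp : ∀ K, 0 ≤ p K) (ha0 : ∀ K, ∀ x ∈ Λ, 0 ≤ a K x) (ha'0 : ∀ K, ∀ x ∈ Λ, 0 ≤ a' K x)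
    (hap : ∀ K, ∀ x ∈ Λ, a K x ≤ p K * g K) (ha'p : ∀ K, ∀ x ∈ Λ, a' K x ≤ p K * g' K) (hw0 : |w0| ≤ B₀) (hwd : ∀ x ∈ Λ, |wd x| ≤ B₀)
    (hW1 : ∀ K, (1 + p K * Real.exp (2 * (l₀ * B₀))) ^ Λ.card - 1 < 1) (hWs : Summable fun K => (1 + p K * Real.exp (2 * (l₀ * B₀))) ^ Λ.card - 1) :
    RelWeightBound l₀ (fun _ => Λ.powerset)
      (fun K t D => (∏ x ∈ D, a K x * Real.exp (t * wd x)) * ∏ _x ∈ Λ \ D, g K * Real.exp (t * w0))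
      (fun K t D => (∏ x ∈ D, a' K x * Real.exp (t * wd x)) * ∏ _x ∈ Λ \ D, g' K * Real.exp (t * w0))
      (fun _ _ => Λ.powerset.filter fun D => n < D.card) fun K => (1 + p K * Real.exp (2 * (l₀ * B₀))) ^ Λ.card - 1 where
  bad_subset _ _ _ := Finset.filter_subset _ _
  nonneg K := sub_nonneg.2 (one_le_pow₀ (by nlinarith [hp K, Real.exp_pos (2 * (l₀ * B₀))]))
  lt_one := hW1
  summable := hWs
  bad_left K t ht := sum_bad_le_defectGas Λ n ht (hg K) (hp K) (ha0 K) (hap K) hw0 hwd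
  bad_right K t ht := sum_bad_le_defectGas Λ n ht (hg' K) (hp K) (ha'0 K) (ha'p K) hw0 hwd

/-- **★★ THE SPINE's NE7 ASSEMBLY `HybridNE7` ON THE IDEAL DEFECT GAS** [folklore ∘ `core_defectGas` + `relWeightBound_defectGas` + `T4MatchingAssembly.hybridNE7_noShell`]: MANY good classes per
level (every defect set of size `≤ n`) served by ONE extensive constant, a NON-EMPTY bad class whenever `n < |Λ|`, NE7b's weight PRODUCED, no shells, and the volume-free remainder
`δ_K = n·ε_K∕vol`. -/
theorem hybridNE7_defectGas (hvol : 0 < vol) (hg : ∀ K, 0 < g K) (hg' : ∀ K, 0 < g' K) (ha : ∀ K, ∀ x ∈ Λ, 0 < a K x) (ha' : ∀ K, ∀ x ∈ Λ, 0 < a' K x)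
    (hp : ∀ K, 0 ≤ p K) (hap : ∀ K, ∀ x ∈ Λ, a K x ≤ p K * g K) (ha'p : ∀ K, ∀ x ∈ Λ, a' K x ≤ p K * g' K) (hw0 : |w0| ≤ B₀) (hwd : ∀ x ∈ Λ, |wd x| ≤ B₀)
    (hε0 : ∀ K, 0 ≤ ε K) (hεs : Summable ε) (hε : ∀ K, ∀ x ∈ Λ, |(Real.log (a' K x) - Real.log (a K x)) - (Real.log (g' K) - Real.log (g K))| ≤ ε K)
    (hW1 : ∀ K, (1 + p K * Real.exp (2 * (l₀ * B₀))) ^ Λ.card - 1 < 1) (hWs : Summable fun K => (1 + p K * Real.exp (2 * (l₀ * B₀))) ^ Λ.card - 1) :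
    HybridNE7 l₀ vol (fun _ => Λ.powerset)
      (fun K t D => (∏ x ∈ D, a K x * Real.exp (t * wd x)) * ∏ _x ∈ Λ \ D, g K * Real.exp (t * w0))
      (fun K t D => (∏ x ∈ D, a' K x * Real.exp (t * wd x)) * ∏ _x ∈ Λ \ D, g' K * Real.exp (t * w0))
      (fun _ _ => Λ.powerset.filter fun D => n < D.card) (fun K => (1 + p K * Real.exp (2 * (l₀ * B₀))) ^ Λ.card - 1)
      (fun _ _ _ => 0) (fun _ _ _ => 0) (fun _ => 0) fun K => n * ε K / vol :=
  hybridNE7_noShell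
    (relWeightBound_defectGas Λ n hg hg' hp (fun K x hx => (ha K x hx).le) (fun K x hx => (ha' K x hx).le) hap ha'p hw0 hwd hW1 hWs)
    (fun K _ _ _ hD => (defectTerm_pos (fun x hx => ha K x (Finset.mem_powerset.1 hD hx)) (hg K)).le)
    (fun K _ _ _ hD => (defectTerm_pos (fun x hx => ha' K x (Finset.mem_powerset.1 hD hx)) (hg' K)).le)
    ((hεs.mul_left (n : ℝ)).div_const vol) (core_defectGas Λ n hvol hg hg' ha ha' hε0 hε)

/-- GEOMETRIC DEFECT DENSITY: with `p_K = p₀·r^K` (`0 ≤ r ≤ 1`) the weight `(1 + p₀r^K·E)^N − 1` is below `(N·p₀E·(1 + p₀E)^N)·r^K`.  The elementary step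
`(1 + q)^N − 1 ≤ N·q·(1 + q)^N` (`q ≥ 0`) is proved inline by induction; it coincides with the tree's `Literature.NumberTheory.Sieve.CubicSieve.one_add_pow_sub_one_le`, not imported
here to keep this file's import closure topical. [folklore] -/
theorem weight_geometric_le {p₀ r E : ℝ} (hp : 0 ≤ p₀) (hr0 : 0 ≤ r) (hr1 : r ≤ 1) (hE : 0 ≤ E) (N K : ℕ) :
    (1 + p₀ * r ^ K * E) ^ N - 1 ≤ (N * (p₀ * E) * (1 + p₀ * E) ^ N) * r ^ K := by
  -- `(1 + q)^N − 1 ≤ N·q·(1 + q)^N` for `q ≥ 0`, by induction on `N`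
  have step : ∀ {q : ℝ}, 0 ≤ q → ∀ N : ℕ, (1 + q) ^ N - 1 ≤ N * q * (1 + q) ^ N := by
    intro q hq N
    induction N with
    | zero => simp
    | succ k ih =>
      have h1 : (1 : ℝ) ≤ (1 + q) ^ k := one_le_pow₀ (by linarith)
      have h2 : (1 + q) ^ k ≤ (1 + q) ^ (k + 1) := pow_le_pow_right₀ (by linarith) (Nat.le_succ k)
      calc (1 + q) ^ (k + 1) - 1 = ((1 + q) ^ k - 1) * (1 + q) + q := by ring
        _ ≤ (k * q * (1 + q) ^ k) * (1 + q) + q := by gcongr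
        _ = k * q * (1 + q) ^ (k + 1) + q * 1 := by ring
        _ ≤ k * q * (1 + q) ^ (k + 1) + q * (1 + q) ^ (k + 1) := by gcongr; exact h1.trans h2
        _ = ((k + 1 : ℕ) : ℝ) * q * (1 + q) ^ (k + 1) := by push_cast; ring
  have hrK : r ^ K ≤ 1 := pow_le_one₀ hr0 hr1
  have hq : 0 ≤ p₀ * r ^ K * E := by positivity
  have hq' : p₀ * r ^ K * E ≤ p₀ * E := by
    calc p₀ * r ^ K * E ≤ p₀ * 1 * E := by gcongr
      _ = p₀ * E := by ring
  calc (1 + p₀ * r ^ K * E) ^ N - 1 ≤ N * (p₀ * r ^ K * E) * (1 + p₀ * r ^ K * E) ^ N := step hq N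
    _ ≤ N * (p₀ * r ^ K * E) * (1 + p₀ * E) ^ N := by gcongr
    _ = (N * (p₀ * E) * (1 + p₀ * E) ^ N) * r ^ K := by ring

/-- **★★ `HybridNE7` ON THE DEFECT GAS WITH A GEOMETRIC DEFECT DENSITY — the two weight conditions DISCHARGED up to ONE displayed numeric condition** [folklore ∘ `hybridNE7_defectGas` +
`weight_geometric_le`]: `a_K ≤ p₀r^K·g_K`, `a′_K ≤ p₀r^K·g′_K` (`0 ≤ r < 1`) and `|Λ|·p₀e^{2l₀B₀}·(1 + p₀e^{2l₀B₀})^{|Λ|} < 1` give the full binder list with the weight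
`W_K = (1 + p₀r^K e^{2l₀B₀})^{|Λ|} − 1 ≤ C·r^K`, MANY good classes and the remainder `n·ε_K∕vol`. -/
theorem hybridNE7_defectGas_geometric {p₀ r : ℝ} (hvol : 0 < vol) (hg : ∀ K, 0 < g K) (hg' : ∀ K, 0 < g' K) (ha : ∀ K, ∀ x ∈ Λ, 0 < a K x)
    (ha' : ∀ K, ∀ x ∈ Λ, 0 < a' K x) (hp : 0 ≤ p₀) (hr0 : 0 ≤ r) (hr1 : r < 1) (hap : ∀ K, ∀ x ∈ Λ, a K x ≤ p₀ * r ^ K * g K)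
    (ha'p : ∀ K, ∀ x ∈ Λ, a' K x ≤ p₀ * r ^ K * g' K) (hw0 : |w0| ≤ B₀) (hwd : ∀ x ∈ Λ, |wd x| ≤ B₀) (hε0 : ∀ K, 0 ≤ ε K) (hεs : Summable ε)
    (hε : ∀ K, ∀ x ∈ Λ, |(Real.log (a' K x) - Real.log (a K x)) - (Real.log (g' K) - Real.log (g K))| ≤ ε K)
    (hC : Λ.card * (p₀ * Real.exp (2 * (l₀ * B₀))) * (1 + p₀ * Real.exp (2 * (l₀ * B₀))) ^ Λ.card < 1) :
    HybridNE7 l₀ vol (fun _ => Λ.powerset)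
      (fun K t D => (∏ x ∈ D, a K x * Real.exp (t * wd x)) * ∏ _x ∈ Λ \ D, g K * Real.exp (t * w0))
      (fun K t D => (∏ x ∈ D, a' K x * Real.exp (t * wd x)) * ∏ _x ∈ Λ \ D, g' K * Real.exp (t * w0))
      (fun _ _ => Λ.powerset.filter fun D => n < D.card) (fun K => (1 + p₀ * r ^ K * Real.exp (2 * (l₀ * B₀))) ^ Λ.card - 1)
      (fun _ _ _ => 0) (fun _ _ _ => 0) (fun _ => 0) fun K => n * ε K / vol := by
  have hE : 0 ≤ Real.exp (2 * (l₀ * B₀)) := (Real.exp_pos _).le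
  have hCnn : 0 ≤ Λ.card * (p₀ * Real.exp (2 * (l₀ * B₀))) * (1 + p₀ * Real.exp (2 * (l₀ * B₀))) ^ Λ.card := by positivity
  have hle : ∀ K, (1 + p₀ * r ^ K * Real.exp (2 * (l₀ * B₀))) ^ Λ.card - 1
      ≤ (Λ.card * (p₀ * Real.exp (2 * (l₀ * B₀))) * (1 + p₀ * Real.exp (2 * (l₀ * B₀))) ^ Λ.card) * r ^ K := fun K =>
    weight_geometric_le hp hr0 hr1.le hE Λ.card K
  have hW0 : ∀ K, 0 ≤ (1 + p₀ * r ^ K * Real.exp (2 * (l₀ * B₀))) ^ Λ.card - 1 := fun K => by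
    have : 0 ≤ p₀ * r ^ K * Real.exp (2 * (l₀ * B₀)) := mul_nonneg (mul_nonneg hp (pow_nonneg hr0 K)) hE
    exact sub_nonneg.2 (one_le_pow₀ (by linarith))
  have hW1 : ∀ K, (1 + p₀ * r ^ K * Real.exp (2 * (l₀ * B₀))) ^ Λ.card - 1 < 1 := fun K =>
    (hle K).trans_lt (lt_of_le_of_lt (mul_le_of_le_one_right hCnn (pow_le_one₀ hr0 hr1.le)) hC)
  have hWs : Summable fun K => (1 + p₀ * r ^ K * Real.exp (2 * (l₀ * B₀))) ^ Λ.card - 1 :=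
    Summable.of_nonneg_of_le hW0 hle ((summable_geometric_of_lt_one hr0 hr1).mul_left _)
  exact hybridNE7_defectGas Λ n (p := fun K => p₀ * r ^ K) hvol hg hg' ha ha' (fun K => mul_nonneg hp (pow_nonneg hr0 K)) hap ha'p hw0 hwd hε0 hεs hε
    hW1 hWs

end Weights

/-! ## §4 Sharpness: with two good classes the constant must be earned per class -/
section Sharp

variable {l₀ vol : ℝ}

/-- **SHARPNESS OF THE UN-HYBRID DIRECTION (p584100 §1)** [folklore]: with TWO good classes a one-constant matching of the TOTALS — here EXACT (`δ = 0`), with NO bad class — does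
NOT yield `Spine.NE7.Core` for ANY summable `δ`, whatever `vol`: classes `Bool`, `Bad = ∅`, run A `≡ 1`, run B `= 2` on `false` and `1∕2` on `true` (totals `2` and `5∕2`, matched by
`c = log(5∕4)`); a common constant would need `vol·δ_K ≥ log 2` at every `K`.  So the one-good-class hypothesis of `core_twoClass_of_core_total` cannot be dropped, and a
many-class `Core` (§2) is information BEYOND total matching. (`0 ≤ l₀` only so that the source window is non-empty.) -/
theorem exists_totalCore_not_core (hl₀ : 0 ≤ l₀) :
    ∃ A B : ℕ → ℝ → Bool → ℝ,
      Core l₀ vol (fun _ => (Finset.univ : Finset Unit)) (fun _ _ => (∅ : Finset Unit)) (fun K t _ => ∑ τ, A K t τ) (fun K t _ => ∑ τ, B K t τ) (fun _ => 0) ∧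
      (∀ (K : ℕ) (t : ℝ) (τ : Bool), 0 < A K t τ ∧ 0 < B K t τ) ∧
      ∀ δ : ℕ → ℝ, Summable δ → ¬ Core l₀ vol (fun _ => (Finset.univ : Finset Bool)) (fun _ _ => (∅ : Finset Bool)) A B δ := by
  refine ⟨fun _ _ _ => 1, fun _ _ τ => bif τ then 1 / 2 else 2, ?_, fun K t τ => ⟨one_pos, by cases τ <;> norm_num⟩, fun δ hδ hcore => ?_⟩
  · intro K
    refine ⟨Real.log (5 / 4), fun t _ u _ => ?_⟩
    have hA : ∑ τ : Bool, (fun (_ : ℕ) (_ : ℝ) (_ : Bool) => (1 : ℝ)) K t τ = 2 := by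
      rw [YMDAG.N18.KingModelLargeField.sum_bool_eq]; norm_num
    have hB : ∑ τ : Bool, (fun (_ : ℕ) (_ : ℝ) (τ : Bool) => bif τ then (1 / 2 : ℝ) else 2) K t τ = 5 / 2 := by
      rw [YMDAG.N18.KingModelLargeField.sum_bool_eq]; norm_num
    simp only [mul_zero, sub_zero, add_zero]
    rw [hA, hB, Real.exp_log (by norm_num)]
    norm_num
  · have hK : ∀ K, Real.log 2 ≤ vol * δ K := fun K => by
      obtain ⟨c, hc⟩ := hcore K
      have h0 : |(0 : ℝ)| ≤ l₀ := by rwa [abs_zero]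
      obtain ⟨-, hf⟩ := hc 0 h0 false (by simp)
      obtain ⟨ht, -⟩ := hc 0 h0 true (by simp)
      simp only [cond_false, cond_true, mul_one] at hf ht
      have h1 : Real.log 2 ≤ c + vol * δ K := by
        rw [← Real.exp_le_exp, Real.exp_log two_pos]; exact hf
      have h2 : c - vol * δ K ≤ Real.log (1 / 2) := by
        rw [← Real.exp_le_exp, Real.exp_log (by norm_num)]; exact ht
      have h3 : Real.log (1 / 2) = -Real.log 2 := by rw [one_div, Real.log_inv]
      linarith
    have hlim : Filter.Tendsto (fun K => vol * δ K) Filter.atTop (nhds 0) := by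
      simpa using hδ.tendsto_atTop_zero.const_mul vol
    obtain ⟨K, hK'⟩ := (hlim.eventually (gt_mem_nhds (Real.log_pos one_lt_two))).exists
    exact absurd (hK K) (not_le.mpr hK')

end Sharp

end Summit.QuantumFields.YangMills.BalabanUVNodes.N19DefectGasManyClasses

end
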